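import Summits.AtomisticToContinuum.Crystallization.Theorems.ReggeStarCoercivityDefectFreeCrystallizesDevelopmentSteps1
import Summits.AtomisticToContinuum.Crystallization.Theorems.ReggeStarCoercivityDefectFreeCrystallizesDevelopmentSteps2
import Summits.AtomisticToContinuum.Crystallization.Theorems.ReggeStarCoercivityDefectFreeCrystallizesDevelopmentVinv
import Summits.AtomisticToContinuum.Crystallization.Theorems.ReggeStarCoercivityDefectFreeCrystallizesDevelopmentAttach1
import Summits.AtomisticToContinuum.Crystallization.Theorems.ReggeStarCoercivityDefectFreeCrystallizesDevelopmentAttach2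
import Summits.AtomisticToContinuum.Crystallization.Theorems.ReggeStarCoercivityDefectFreeCrystallizesDevelopmentComm1
import Summits.AtomisticToContinuum.Crystallization.Theorems.ReggeStarCoercivityDefectFreeCrystallizesDevelopmentComm2
import Summits.AtomisticToContinuum.Crystallization.Theorems.PalmUnimodularRigidityShellsToBarlowChartTransportVComm1

/-!
# Commutation of `V⁻¹` with `I` and `J` (part 1/3) (port to the abstract `1/20` chart clauses)

Port of `Theorems/PalmUnimodularRigidityShellsToBarlowChartTransportVComm1.lean` (crux 9227, line
`develop-the-model-growth-descent`) to the ABSTRACT chart clauses of line `palm-good-law` of crux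
stmt-AtomisticToContinuum-13603 (stub R1a4 `stub_combinatorialDevelopment`): the integer-chart hypothesis
`hch : ∀ z ∈ S, IsZChart S z …` is replaced by the section hypothesis `hch` = (pattern `fcc3Int`/`hcpInt`,
labelling `nb z` bijective onto the bonded neighbours, exact links) at every site ∧ the transfer identity for
every bonded pair; statements and proofs are otherwise verbatim (the transports `Istep, …, frameAt` and the
pattern facts `TransportPatterns*` are reused by name).  All `[folklore]` (HalesDSP2012 §1.3).
-/

noncomputable section

namespace Summit.AtomisticToContinuum.Crystallization.Theorems.PalmGoodLaw.Development

open Literature.Geometry.DiscreteGeometry Literature.MathematicalPhysics.StatisticalMechanics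
open Summit.AtomisticToContinuum.Crystallization.Theorems.ShellsToBarlowChartNegative
open Summit.AtomisticToContinuum.Crystallization.Theorems.PalmUnimodularRigidityShellsToBarlowChart

variable {S : Set (EuclideanSpace ℝ (Fin 3))} {Pc : (EuclideanSpace ℝ (Fin 3)) → Finset (Fin 3 → ℤ)}
  {nb : (EuclideanSpace ℝ (Fin 3)) → (Fin 3 → ℤ) → (EuclideanSpace ℝ (Fin 3))}
  (hch : (∀ z ∈ S, (Pc z = fcc3Int ∨ Pc z = hcpInt) ∧
      Set.BijOn (nb z) (↑(Pc z) : Set (Fin 3 → ℤ)) {y | y ∈ S ∧ (0 < dist z y ∧ dist z y ≤ 28 / 25)} ∧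
      (∀ t ∈ Pc z, ∀ t' ∈ Pc z,
        ((0 < dist (nb z t) (nb z t') ∧ dist (nb z t) (nb z t') ≤ 28 / 25) ↔ sqNormInt (t - t') = 18))) ∧
    (∀ x ∈ S, ∀ y ∈ S, (0 < dist x y ∧ dist x y ≤ 28 / 25) →
      ∀ (z z' : EuclideanSpace ℝ (Fin 3)) (t t' u u' : Fin 3 → ℤ),
        ((t = 0 ∧ z = x) ∨ (t ∈ Pc x ∧ z = nb x t)) → ((t' = 0 ∧ z' = x) ∨ (t' ∈ Pc x ∧ z' = nb x t')) →
        ((u = 0 ∧ z = y) ∨ (u ∈ Pc y ∧ z = nb y u)) → ((u' = 0 ∧ z' = y) ∨ (u' ∈ Pc y ∧ z' = nb y u')) →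
        sqNormInt (u - u') = sqNormInt (t - t')))

include hch in
/-- **Lower attachment across J, letter below `+1`** (from the I-version by the swap symmetry).
[folklore] -/
theorem attach_lower_J_pos {x : (EuclideanSpace ℝ (Fin 3))} (hx : x ∈ S) {t₁ t₂ : Fin 3 → ℤ} {U : Finset (Fin 3 → ℤ)} (hU : IsFrame (Pc x) t₁ t₂ U) (hlp : lowerParity t₁ t₂ (lowerCap (Pc x) t₁ t₂ U) = 1) (hreg : Pc (nb x t₂) = fcc3Int ∨ Pc x = hcpInt ∨ (-zlab Pc nb (nb x t₂) x ∈ Pc (nb x t₂) ∧ -zlab Pc nb (nb x t₂) (nb x t₁) ∈ Pc (nb x t₂))) : lowerParity (Jstep Pc nb ⟨x, t₁, t₂, U⟩).t₁ (Jstep Pc nb ⟨x, t₁, t₂, U⟩).t₂ (lowerCap (Pc (nb x t₂)) (Jstep Pc nb ⟨x, t₁, t₂, U⟩).t₁ (Jstep Pc nb ⟨x, t₁, t₂, U⟩).t₂ (Jstep Pc nb ⟨x, t₁, t₂, U⟩).U) = 1 ∧ nb (nb x t₂) (apexOf (Jstep Pc nb ⟨x, t₁, t₂, U⟩).t₁ (Jstep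 Pc nb ⟨x, t₁, t₂, U⟩).t₂ (lowerCap (Pc (nb x t₂)) (Jstep Pc nb ⟨x, t₁, t₂, U⟩).t₁ (Jstep Pc nb ⟨x, t₁, t₂, U⟩).t₂ (Jstep Pc nb ⟨x, t₁, t₂, U⟩).U)) = nb x (apexOf t₁ t₂ (lowerCap (Pc x) t₁ t₂ U) + t₂) ∧ zlab Pc nb (nb x t₂) (nb x (apexOf t₁ t₂ (lowerCap (Pc x) t₁ t₂ U) + t₂)) = apexOf (Jstep Pc nb ⟨x, t₁, t₂, U⟩).t₁ (Jstep Pc nb ⟨x, t₁, t₂, U⟩).t₂ (lowerCap (Pc (nb x t₂)) (Jstep Pc nb ⟨x, t₁, t₂, U⟩).t₁ (Jstep Pc nb ⟨x, t₁, t₂, U⟩).t₂ (Jstep Pc nb ⟨x, t₁, t₂, U⟩).U) := by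
  have hPx := pattern_cases hch hx
  have hU' : IsFrame (Pc x) t₂ t₁ U := isFrame_swap hU
  have hlp' : lowerParity t₂ t₁ (lowerCap (Pc x) t₂ t₁ U) = 1 := by
    rw [lowerCap_comm, lowerParity_swap]; exact hlp
  obtain ⟨h1, h2, h3⟩ := attach_lower_I_pos hch hx hU' hlp' hreg
  obtain ⟨-, -, -, -, -, -, -, -, -, -, -, hframe', -⟩ := Istep_spec hch hx hU' hreg
  have hPy := pattern_cases hch (nb_mem hch hx (hU.2.1 (mem_hexLabels_iff.2 (Or.inr (Or.inl rfl))))).1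
  have hLx : lowerCap (Pc x) t₂ t₁ U = lowerCap (Pc x) t₁ t₂ U := lowerCap_comm _ _ _ _
  have hax : apexOf t₂ t₁ (lowerCap (Pc x) t₁ t₂ U) = apexOf t₁ t₂ (lowerCap (Pc x) t₁ t₂ U) :=
    apexOf_swap hPx (isFrame_lowerCap hPx hU)
  rw [hLx, hax] at h2 h3
  rw [Jstep_swap]
  have hLy : lowerCap (Pc (nb x t₂)) (Istep Pc nb ⟨x, t₂, t₁, U⟩).t₂ (Istep Pc nb ⟨x, t₂, t₁, U⟩).t₁
      (Istep Pc nb ⟨x, t₂, t₁, U⟩).U = lowerCap (Pc (nb x t₂)) (Istep Pc nb ⟨x, t₂, t₁, U⟩).t₁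
      (Istep Pc nb ⟨x, t₂, t₁, U⟩).t₂ (Istep Pc nb ⟨x, t₂, t₁, U⟩).U := lowerCap_comm _ _ _ _
  have hay : apexOf (Istep Pc nb ⟨x, t₂, t₁, U⟩).t₂ (Istep Pc nb ⟨x, t₂, t₁, U⟩).t₁
      (lowerCap (Pc (nb x t₂)) (Istep Pc nb ⟨x, t₂, t₁, U⟩).t₁ (Istep Pc nb ⟨x, t₂, t₁, U⟩).t₂
        (Istep Pc nb ⟨x, t₂, t₁, U⟩).U) = apexOf (Istep Pc nb ⟨x, t₂, t₁, U⟩).t₁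
      (Istep Pc nb ⟨x, t₂, t₁, U⟩).t₂ (lowerCap (Pc (nb x t₂)) (Istep Pc nb ⟨x, t₂, t₁, U⟩).t₁
        (Istep Pc nb ⟨x, t₂, t₁, U⟩).t₂ (Istep Pc nb ⟨x, t₂, t₁, U⟩).U) :=
    apexOf_swap hPy (isFrame_lowerCap hPy hframe')
  show lowerParity _ _ (lowerCap (Pc (nb x t₂)) (Istep Pc nb ⟨x, t₂, t₁, U⟩).t₂
      (Istep Pc nb ⟨x, t₂, t₁, U⟩).t₁ (Istep Pc nb ⟨x, t₂, t₁, U⟩).U) = 1 ∧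
    nb (nb x t₂) (apexOf _ _ (lowerCap (Pc (nb x t₂)) (Istep Pc nb ⟨x, t₂, t₁, U⟩).t₂
      (Istep Pc nb ⟨x, t₂, t₁, U⟩).t₁ (Istep Pc nb ⟨x, t₂, t₁, U⟩).U)) = _ ∧
    _ = apexOf _ _ (lowerCap (Pc (nb x t₂)) (Istep Pc nb ⟨x, t₂, t₁, U⟩).t₂
      (Istep Pc nb ⟨x, t₂, t₁, U⟩).t₁ (Istep Pc nb ⟨x, t₂, t₁, U⟩).U)
  rw [hLy, lowerParity_swap, hay]
  exact ⟨h1, h2, h3⟩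

include hch in
/-- **Lower attachment across J, letter below `−1`** (from the I-version by the swap symmetry).
[folklore] -/
theorem attach_lower_J_neg {x : (EuclideanSpace ℝ (Fin 3))}
    (hx : x ∈ S) {t₁ t₂ : Fin 3 → ℤ} {U : Finset (Fin 3 → ℤ)} (hU : IsFrame (Pc x) t₁ t₂ U)
    (hlp : lowerParity t₁ t₂ (lowerCap (Pc x) t₁ t₂ U) = -1)
    (hreg : Pc (nb x t₂) = fcc3Int ∨ Pc x = hcpInt ∨
      (-zlab Pc nb (nb x t₂) x ∈ Pc (nb x t₂) ∧ -zlab Pc nb (nb x t₂) (nb x t₁) ∈ Pc (nb x t₂))) :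
    lowerParity (Jstep Pc nb ⟨x, t₁, t₂, U⟩).t₁ (Jstep Pc nb ⟨x, t₁, t₂, U⟩).t₂
        (lowerCap (Pc (nb x t₂)) (Jstep Pc nb ⟨x, t₁, t₂, U⟩).t₁ (Jstep Pc nb ⟨x, t₁, t₂, U⟩).t₂
          (Jstep Pc nb ⟨x, t₁, t₂, U⟩).U) = -1 ∧
    nb (nb x t₂) (apexOf (Jstep Pc nb ⟨x, t₁, t₂, U⟩).t₁ (Jstep Pc nb ⟨x, t₁, t₂, U⟩).t₂
        (lowerCap (Pc (nb x t₂)) (Jstep Pc nb ⟨x, t₁, t₂, U⟩).t₁ (Jstep Pc nb ⟨x, t₁, t₂, U⟩).t₂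
          (Jstep Pc nb ⟨x, t₁, t₂, U⟩).U) - (Jstep Pc nb ⟨x, t₁, t₂, U⟩).t₂) =
      nb x (apexOf t₁ t₂ (lowerCap (Pc x) t₁ t₂ U)) ∧
    zlab Pc nb (nb x t₂) (nb x (apexOf t₁ t₂ (lowerCap (Pc x) t₁ t₂ U))) =
      apexOf (Jstep Pc nb ⟨x, t₁, t₂, U⟩).t₁ (Jstep Pc nb ⟨x, t₁, t₂, U⟩).t₂
        (lowerCap (Pc (nb x t₂)) (Jstep Pc nb ⟨x, t₁, t₂, U⟩).t₁ (Jstep Pc nb ⟨x, t₁, t₂, U⟩).t₂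
          (Jstep Pc nb ⟨x, t₁, t₂, U⟩).U) - (Jstep Pc nb ⟨x, t₁, t₂, U⟩).t₂ := by
  have hPx := pattern_cases hch hx
  have hU' : IsFrame (Pc x) t₂ t₁ U := isFrame_swap hU
  have hlp' : lowerParity t₂ t₁ (lowerCap (Pc x) t₂ t₁ U) = -1 := by
    rw [lowerCap_comm, lowerParity_swap]; exact hlp
  obtain ⟨h1, h2, h3⟩ := attach_lower_I_neg hch hx hU' hlp' hreg
  obtain ⟨-, -, -, -, -, -, -, -, -, -, -, hframe', -⟩ := Istep_spec hch hx hU' hreg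
  have hPy := pattern_cases hch (nb_mem hch hx (hU.2.1 (mem_hexLabels_iff.2 (Or.inr (Or.inl rfl))))).1
  have hLx : lowerCap (Pc x) t₂ t₁ U = lowerCap (Pc x) t₁ t₂ U := lowerCap_comm _ _ _ _
  have hax : apexOf t₂ t₁ (lowerCap (Pc x) t₁ t₂ U) = apexOf t₁ t₂ (lowerCap (Pc x) t₁ t₂ U) :=
    apexOf_swap hPx (isFrame_lowerCap hPx hU)
  rw [hLx, hax] at h2 h3
  rw [Jstep_swap]
  have hLy : lowerCap (Pc (nb x t₂)) (Istep Pc nb ⟨x, t₂, t₁, U⟩).t₂ (Istep Pc nb ⟨x, t₂, t₁, U⟩).t₁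
      (Istep Pc nb ⟨x, t₂, t₁, U⟩).U = lowerCap (Pc (nb x t₂)) (Istep Pc nb ⟨x, t₂, t₁, U⟩).t₁
      (Istep Pc nb ⟨x, t₂, t₁, U⟩).t₂ (Istep Pc nb ⟨x, t₂, t₁, U⟩).U := lowerCap_comm _ _ _ _
  have hay : apexOf (Istep Pc nb ⟨x, t₂, t₁, U⟩).t₂ (Istep Pc nb ⟨x, t₂, t₁, U⟩).t₁
      (lowerCap (Pc (nb x t₂)) (Istep Pc nb ⟨x, t₂, t₁, U⟩).t₁ (Istep Pc nb ⟨x, t₂, t₁, U⟩).t₂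
        (Istep Pc nb ⟨x, t₂, t₁, U⟩).U) = apexOf (Istep Pc nb ⟨x, t₂, t₁, U⟩).t₁
      (Istep Pc nb ⟨x, t₂, t₁, U⟩).t₂ (lowerCap (Pc (nb x t₂)) (Istep Pc nb ⟨x, t₂, t₁, U⟩).t₁
        (Istep Pc nb ⟨x, t₂, t₁, U⟩).t₂ (Istep Pc nb ⟨x, t₂, t₁, U⟩).U) :=
    apexOf_swap hPy (isFrame_lowerCap hPy hframe')
  show lowerParity _ _ (lowerCap (Pc (nb x t₂)) (Istep Pc nb ⟨x, t₂, t₁, U⟩).t₂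
      (Istep Pc nb ⟨x, t₂, t₁, U⟩).t₁ (Istep Pc nb ⟨x, t₂, t₁, U⟩).U) = -1 ∧
    nb (nb x t₂) (apexOf _ _ (lowerCap (Pc (nb x t₂)) (Istep Pc nb ⟨x, t₂, t₁, U⟩).t₂
      (Istep Pc nb ⟨x, t₂, t₁, U⟩).t₁ (Istep Pc nb ⟨x, t₂, t₁, U⟩).U) - _) = _ ∧
    _ = apexOf _ _ (lowerCap (Pc (nb x t₂)) (Istep Pc nb ⟨x, t₂, t₁, U⟩).t₂
      (Istep Pc nb ⟨x, t₂, t₁, U⟩).t₁ (Istep Pc nb ⟨x, t₂, t₁, U⟩).U) - _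
  rw [hLy, lowerParity_swap, hay]
  exact ⟨h1, h2, h3⟩

include hch in
/-- **`V⁻¹ ∘ I`, the point.**  For a valid frame `g` whose four in-layer transports are valid,
the lower apex site below `Ix` is the `t₁`-neighbour of the frame `V⁻¹ g` at the lower apex site
`d` below `x`, and its label at `d` is `(V⁻¹ g).t₁`: in the model both are `(k−1, i+1, j)`.
[folklore] -/
theorem VinvStep_Istep_pt {x : (EuclideanSpace ℝ (Fin 3))}
    (hx : x ∈ S) {t₁ t₂ : Fin 3 → ℤ} {U : Finset (Fin 3 → ℤ)} (hU : IsFrame (Pc x) t₁ t₂ U)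
    (hI : IsFrame (Pc (nb x t₁)) (Istep Pc nb ⟨x, t₁, t₂, U⟩).t₁ (Istep Pc nb ⟨x, t₁, t₂, U⟩).t₂
      (Istep Pc nb ⟨x, t₁, t₂, U⟩).U)
    (hJ : IsFrame (Pc (nb x t₂)) (Jstep Pc nb ⟨x, t₁, t₂, U⟩).t₁ (Jstep Pc nb ⟨x, t₁, t₂, U⟩).t₂
      (Jstep Pc nb ⟨x, t₁, t₂, U⟩).U)
    (hIi : IsFrame (Pc (nb x (-t₁))) (IinvStep Pc nb ⟨x, t₁, t₂, U⟩).t₁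
      (IinvStep Pc nb ⟨x, t₁, t₂, U⟩).t₂ (IinvStep Pc nb ⟨x, t₁, t₂, U⟩).U)
    (hJi : IsFrame (Pc (nb x (-t₂))) (JinvStep Pc nb ⟨x, t₁, t₂, U⟩).t₁
      (JinvStep Pc nb ⟨x, t₁, t₂, U⟩).t₂ (JinvStep Pc nb ⟨x, t₁, t₂, U⟩).U) :
    (VinvStep Pc nb (Istep Pc nb ⟨x, t₁, t₂, U⟩)).pt =
        nb (VinvStep Pc nb ⟨x, t₁, t₂, U⟩).pt (VinvStep Pc nb ⟨x, t₁, t₂, U⟩).t₁ ∧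
      (0 < dist (VinvStep Pc nb ⟨x, t₁, t₂, U⟩).pt (VinvStep Pc nb (Istep Pc nb ⟨x, t₁, t₂, U⟩)).pt ∧
        dist (VinvStep Pc nb ⟨x, t₁, t₂, U⟩).pt (VinvStep Pc nb (Istep Pc nb ⟨x, t₁, t₂, U⟩)).pt ≤ 28 / 25) ∧
      zlab Pc nb (VinvStep Pc nb ⟨x, t₁, t₂, U⟩).pt (VinvStep Pc nb (Istep Pc nb ⟨x, t₁, t₂, U⟩)).pt =
        (VinvStep Pc nb ⟨x, t₁, t₂, U⟩).t₁ := by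
  have hregI := hregI_of_valid (Pc := Pc) (nb := nb) hI
  obtain ⟨hyS, hbxy, hwP, hwx, -, -, -, -, -, -, -, hframe, hparI, -⟩ := Istep_spec hch hx hU hregI
  obtain ⟨hd'L, hdS, hbd, hξP, hξx, hframeVi, -, hbr⟩ := VinvStep_spec hch hx hU hI hJ hIi hJi
  have hPx := pattern_cases hch hx
  have hPy := pattern_cases hch hyS
  have hPd := pattern_cases hch hdS
  obtain ⟨h12, hhex, hUP, -, -⟩ := id hU
  have ht₁ : t₁ ∈ Pc x := hhex (mem_hexLabels_iff.2 (Or.inl rfl))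
  have ht₂ : t₂ ∈ Pc x := hhex (mem_hexLabels_iff.2 (Or.inr (Or.inl rfl)))
  have hnt₁ : -t₁ ∈ Pc x := hhex (mem_hexLabels_iff.2 (Or.inr (Or.inr (Or.inr (Or.inl rfl)))))
  -- canonical names
  set d' := apexOf t₁ t₂ (lowerCap (Pc x) t₁ t₂ U) with hd'_def
  have hd'P : d' ∈ Pc x := (mem_lowerCap_iff.1 hd'L).1
  have hd'hex : d' ∉ hexLabels t₁ t₂ := (mem_lowerCap_iff.1 hd'L).2.1
  have hpt : (VinvStep Pc nb (Istep Pc nb ⟨x, t₁, t₂, U⟩)).pt =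
      nb (nb x t₁) (apexOf (Istep Pc nb ⟨x, t₁, t₂, U⟩).t₁ (Istep Pc nb ⟨x, t₁, t₂, U⟩).t₂
        (lowerCap (Pc (nb x t₁)) (Istep Pc nb ⟨x, t₁, t₂, U⟩).t₁ (Istep Pc nb ⟨x, t₁, t₂, U⟩).t₂
          (Istep Pc nb ⟨x, t₁, t₂, U⟩).U)) := rfl
  have hVpt : (VinvStep Pc nb ⟨x, t₁, t₂, U⟩).pt = nb x d' := rfl
  rw [hpt, hVpt] at *
  set d := nb x d' with hd_def
  set τ₁ := (VinvStep Pc nb ⟨x, t₁, t₂, U⟩).t₁ with hτ₁_def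
  have hτ₁P : τ₁ ∈ Pc d := hframeVi.2.1 (mem_hexLabels_iff.2 (Or.inl rfl))
  have Dτ₁ : sqNormInt τ₁ = 18 := (wsqNormInt_eq hch hdS) hτ₁P
  set ξ := zlab Pc nb d x with hξ_def
  rcases hbr with ⟨hlp, hUd, hnI, -, hLeq⟩ | ⟨hlp, hUd, hnI, -, hLeq⟩
  · /- letter below `+1`: `d₁ = nb x (d' + t₁)` is read in the chart of `x` -/
    obtain ⟨-, hatt, -⟩ := attach_lower_I_pos hch hx hU hlp hregI
    rw [hatt]
    obtain ⟨-, -, -, hd1, hd2, -⟩ := pos_form_of_lowerParity hPx hU hlp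
    have hdx := dist_oddCap (Pc x) hPx t₁ ht₁ t₂ ht₂ d' hd'P h12 hhex hd'hex hd1 hd2
    -- `η = ξ − τ₁` labels `I⁻¹x`
    have hηP : ξ - τ₁ ∈ Pc d := hframeVi.2.2.1 (by rw [hUd]; simp)
    have hη : zlab Pc nb d (nb x (-t₁)) = ξ - τ₁ := by rw [← hnI]; exact zlab_nb hch hdS hηP
    have hbdm : 0 < dist d (nb x (-t₁)) ∧ dist d (nb x (-t₁)) ≤ 28 / 25 :=
      (bond_nb_iff hch hx hd'P hnt₁).2 (by rw [sqNormInt_sub_comm]; exact hdx.1)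
    have hbdd₁ : 0 < dist d (nb x (d' + t₁)) ∧ dist d (nb x (d' + t₁)) ≤ 28 / 25 :=
      (bond_nb_iff hch hx hd'P hd1).2 hdx.2.2.2.2.2.2.2.2.2.2.1
    have hd₁S : nb x (d' + t₁) ∈ S := (nb_mem hch hx hd1).1
    have hθ := zlab_spec hch hdS hd₁S hbdd₁
    have Dθξ : sqNormInt (zlab Pc nb d (nb x (d' + t₁)) - ξ) = 18 := by
      rw [hξ_def, transfer_nb_centre hch hx hdS hbd hd1 hbdd₁]; exact (wsqNormInt_eq hch hx) hd1
    have Dθη : sqNormInt (zlab Pc nb d (nb x (d' + t₁)) - zlab Pc nb d (nb x (-t₁))) = 54 := by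
      rw [transfer_nb_nb hch hx hdS hbd hd1 hnt₁ hbdd₁ hbdm]
      exact (dist_oddCap_ca (Pc x) hPx t₁ ht₁ t₂ ht₂ d' hd'P h12 hhex hd'hex hd1 hd2).2.2.2.1
    have hθeq : zlab Pc nb d (nb x (d' + t₁)) = τ₁ := by
      have h := label_third_vertex (Pc d) hPd (ξ - τ₁) hηP ξ hξP _ hθ.1
        (by rw [show ξ - τ₁ - ξ = -τ₁ by abel, sqNormInt_neg]; exact Dτ₁)
        Dθξ (by rw [← hη]; exact Dθη) (by rw [show ξ - (ξ - τ₁) = τ₁ by abel]; exact hτ₁P)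
      rw [h]; abel
    refine ⟨?_, hbdd₁, hθeq⟩
    rw [← hθeq]; exact hθ.2.symm
  · /- letter below `−1`: `d = nb y (dL' − a')`, `d₁ = nb y dL'` are read in the chart of `y` -/
    obtain ⟨hlp', hatt, hlab⟩ := attach_lower_I_neg hch hx hU hlp hregI
    set a' := (Istep Pc nb ⟨x, t₁, t₂, U⟩).t₁ with ha'
    set b' := (Istep Pc nb ⟨x, t₁, t₂, U⟩).t₂ with hb'
    set U' := (Istep Pc nb ⟨x, t₁, t₂, U⟩).U with hU'
    obtain ⟨h12', hhex', hUP', -, -⟩ := id hframe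
    have ha'P : a' ∈ Pc (nb x t₁) := hhex' (mem_hexLabels_iff.2 (Or.inl rfl))
    have hb'P : b' ∈ Pc (nb x t₁) := hhex' (mem_hexLabels_iff.2 (Or.inr (Or.inl rfl)))
    obtain ⟨hdL'L, hdL'P, hdL'hex, hd1', hd2', hL'eq⟩ := neg_form_of_lowerParity hPy hframe hlp'
    set dL' := apexOf a' b' (lowerCap (Pc (nb x t₁)) a' b' U') with hdL'_def
    have hdy : nb (nb x t₁) (dL' - a') = d := hatt
    -- `η₊ = ξ + τ₁` labels `Ix = y`
    have hηP : ξ + τ₁ ∈ Pc d := hframeVi.2.2.1 (by rw [hUd]; simp)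
    have hη : zlab Pc nb d (nb x t₁) = ξ + τ₁ := by rw [← hnI]; exact zlab_nb hch hdS hηP
    have hbdy : 0 < dist d (nb x t₁) ∧ dist d (nb x t₁) ≤ 28 / 25 := by
      rw [← hnI]; exact (nb_mem hch hdS hηP).2
    have hbdd₁ : 0 < dist d (nb (nb x t₁) dL') ∧ dist d (nb (nb x t₁) dL') ≤ 28 / 25 := by
      have := (bond_nb_iff hch hyS hd1' hdL'P).2 (by
        rw [show dL' - a' - dL' = -a' by abel, sqNormInt_neg]; exact (wsqNormInt_eq hch hyS) ha'P)
      rwa [hdy] at this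
    have hd₁S : nb (nb x t₁) dL' ∈ S := (nb_mem hch hyS hdL'P).1
    have hθ := zlab_spec hch hdS hd₁S hbdd₁
    have Dθη : sqNormInt (zlab Pc nb d (nb (nb x t₁) dL') - zlab Pc nb d (nb x t₁)) = 18 := by
      rw [transfer_nb_centre hch hyS hdS (bond_symm hbdy) hdL'P hbdd₁]
      exact (wsqNormInt_eq hch hyS) hdL'P
    have Dθξ : sqNormInt (zlab Pc nb d (nb (nb x t₁) dL') - ξ) = 54 := by
      have hbdx : 0 < dist d (nb (nb x t₁) (zlab Pc nb (nb x t₁) x)) ∧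
          dist d (nb (nb x t₁) (zlab Pc nb (nb x t₁) x)) ≤ 28 / 25 := by rw [hwx]; exact bond_symm hbd
      have htr := transfer_nb_nb hch hyS hdS (bond_symm hbdy) hdL'P hwP hbdd₁ hbdx
      rw [hwx] at htr
      rw [hξ_def, htr]
      have h54 := (dist_evenCap_c (Pc (nb x t₁)) hPy a' ha'P b' hb'P dL' hdL'P h12' hhex' hdL'hex
        hd1' hd2').2.2.2.1
      have e : -a' = zlab Pc nb (nb x t₁) x := by show -(-zlab Pc nb (nb x t₁) x) = _; rw [neg_neg]
      rwa [e] at h54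
    have hθeq : zlab Pc nb d (nb (nb x t₁) dL') = τ₁ := by
      have h := label_third_vertex (Pc d) hPd ξ hξP (ξ + τ₁) hηP _ hθ.1
        (by rw [show ξ - (ξ + τ₁) = -τ₁ by abel, sqNormInt_neg]; exact Dτ₁)
        (by rw [← hη]; exact Dθη) Dθξ (by rw [show ξ + τ₁ - ξ = τ₁ by abel]; exact hτ₁P)
      rw [h]; abel
    refine ⟨?_, hbdd₁, hθeq⟩
    rw [← hθeq]; exact hθ.2.symm

include hch in
/-- **`V⁻¹ ∘ J`, the point** (from `VinvStep_Istep_pt` by the swap symmetry). [folklore] -/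
theorem VinvStep_Jstep_pt {x : (EuclideanSpace ℝ (Fin 3))}
    (hx : x ∈ S) {t₁ t₂ : Fin 3 → ℤ} {U : Finset (Fin 3 → ℤ)} (hU : IsFrame (Pc x) t₁ t₂ U)
    (hI : IsFrame (Pc (nb x t₁)) (Istep Pc nb ⟨x, t₁, t₂, U⟩).t₁ (Istep Pc nb ⟨x, t₁, t₂, U⟩).t₂
      (Istep Pc nb ⟨x, t₁, t₂, U⟩).U)
    (hJ : IsFrame (Pc (nb x t₂)) (Jstep Pc nb ⟨x, t₁, t₂, U⟩).t₁ (Jstep Pc nb ⟨x, t₁, t₂, U⟩).t₂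
      (Jstep Pc nb ⟨x, t₁, t₂, U⟩).U)
    (hIi : IsFrame (Pc (nb x (-t₁))) (IinvStep Pc nb ⟨x, t₁, t₂, U⟩).t₁
      (IinvStep Pc nb ⟨x, t₁, t₂, U⟩).t₂ (IinvStep Pc nb ⟨x, t₁, t₂, U⟩).U)
    (hJi : IsFrame (Pc (nb x (-t₂))) (JinvStep Pc nb ⟨x, t₁, t₂, U⟩).t₁
      (JinvStep Pc nb ⟨x, t₁, t₂, U⟩).t₂ (JinvStep Pc nb ⟨x, t₁, t₂, U⟩).U) :
    (VinvStep Pc nb (Jstep Pc nb ⟨x, t₁, t₂, U⟩)).pt =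
        nb (VinvStep Pc nb ⟨x, t₁, t₂, U⟩).pt (VinvStep Pc nb ⟨x, t₁, t₂, U⟩).t₂ ∧
      (0 < dist (VinvStep Pc nb ⟨x, t₁, t₂, U⟩).pt (VinvStep Pc nb (Jstep Pc nb ⟨x, t₁, t₂, U⟩)).pt ∧
        dist (VinvStep Pc nb ⟨x, t₁, t₂, U⟩).pt (VinvStep Pc nb (Jstep Pc nb ⟨x, t₁, t₂, U⟩)).pt ≤ 28 / 25) ∧
      zlab Pc nb (VinvStep Pc nb ⟨x, t₁, t₂, U⟩).pt (VinvStep Pc nb (Jstep Pc nb ⟨x, t₁, t₂, U⟩)).pt =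
        (VinvStep Pc nb ⟨x, t₁, t₂, U⟩).t₂ := by
  have hPx := pattern_cases hch hx
  obtain ⟨hI', hJ', hIi', hJi'⟩ := swap_hyps (Pc := Pc) (nb := nb) hI hJ hIi hJi
  have hU' : IsFrame (Pc x) t₂ t₁ U := isFrame_swap hU
  obtain ⟨h1, h2, h3⟩ := VinvStep_Istep_pt hch hx hU' hI' hJ' hIi' hJi'
  have hregI' := hregI_of_valid (Pc := Pc) (nb := nb) hI'
  obtain ⟨hyS, -, -, -, -, -, -, -, -, -, -, hframe', -⟩ := Istep_spec hch hx hU' hregI'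
  have hPy := pattern_cases hch hyS
  have hVJ : (VinvStep Pc nb (Jstep Pc nb ⟨x, t₁, t₂, U⟩)).pt =
      (VinvStep Pc nb (Istep Pc nb ⟨x, t₂, t₁, U⟩)).pt := by
    rw [Jstep_swap]
    have h4 := congrArg ZFrame.pt (VinvStep_swap (nb := nb) hPy hframe')
    exact h4
  rw [VinvStep_swap hPx hU] at h1 h2 h3
  rw [hVJ]
  exact ⟨h1, h2, h3⟩

/-- Landing anchor of this helper file (registered on crux stmt-AtomisticToContinuum-13603 for the port of stub R1a4;
a label of the integer kissing pattern). [folklore] -/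
theorem development_vcomm1_anchor : ![3, 0, -3] ∈ hcpInt := by decide

end Summit.AtomisticToContinuum.Crystallization.Theorems.PalmGoodLaw.Development

end
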